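import Mathlib.Analysis.SpecialFunctions.ExpDeriv
import Mathlib.Analysis.SpecialFunctions.Log.Basic
import HarnessLib

/-!
# Kanazawa's counterexample to the continuation step of Tomboulis's Appendix C (Ito–Seiler 2008/2009):
# `Ψ(λ, t) = e^{-t} − 1 + 2λ` has `Ψ_{,t} ≠ 0` everywhere and a root at `λ = 0`, but no root at `λ = 1`

Topic `Literature/MathematicalPhysics/QuantumFieldTheory` (next to `TomboulisVortexDecimation.lean`, which types the objects of
E. T. Tomboulis, arXiv:0707.2179, and the inequalities disputed by K. R. Ito and E. Seiler).

Tomboulis's Appendix C seeks a solution `t` of `Z̃⁺(β,h,α_h(t),t) = Z⁺_{Λ^{(n-1)}}` by the «method of imbedding or continuity»: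
with `Ψ(λ,t)` of his (C.6), `Ψ(0,t₀) = 0` is known and `Ψ(1,t) = 0` is wanted; «By the implicit function theorem, if grad `Ψ` is
continuous and `(∂Ψ/∂t)(0,t₀) ≠ 0`, there exists a branch `t(λ)` through `(0,t₀)` … this procedure constructs the desired branch
away from the initial point as long as `Ψ_{,t} ≠ 0` along the branch. The existence of a solution `t(1)` is therefore guaranteed by
basic existence theorems … if this condition is satisfied throughout the interval `0 ≤ λ ≤ 1`.»

Ito–Seiler, arXiv:0803.3019 §3.2, Problem 3 (verbatim): «The implicit function theorem is used to obtain `t(λ)` which satisfies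
`Ψ(λ,t) = 0`. It is not proven that `t(λ)` can be extended from `t=0` to `t=1` even if `Ψ_t ≠ 0`.» and §3.3: «But the condition
`Ψ_t(λ,t) ≠ 0` does not guarantee that `t(λ)` can be defined for all `λ`. The following example is given by Kanazawa [Kana]:
`Ψ(λ,t) = e^{-t} − 1 + 2λ`.»  The same example is printed in K. R. Ito, E. Seiler, PoS Confinement8 (2008) 034, arXiv:0901.4246,
Sect. 4(b) [ItoSeiler2009Critical].

This file records the example as theorems: `∂Ψ/∂t = −e^{−t} ≠ 0` for all `(λ,t)`; `Ψ(0,0) = 0`; `Ψ(1,t) = e^{−t} + 1 > 0` has no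
root; more precisely `Ψ(λ,·)` has a (unique) root iff `λ < 1/2`, namely `t(λ) = −log(1 − 2λ)`, so the branch through `(0,0)` leaves
every bounded region as `λ ↑ 1/2` and does not reach `λ = 1`.  HONEST FRAMING: a two-line calculus example; it says nothing about
whether Tomboulis's actual `Ψ` of (C.6) has this defect — only that `Ψ_{,t} ≠ 0` alone does not yield `t(1)` (Ito–Seiler's point,
conceded as a gap in the printed argument; the census's `ISProblem2` rows are the instance-by-instance substitute).

References: K. R. Ito, E. Seiler, arXiv:0803.3019 (2008) §3.2 Problem 3, §3.3; K. R. Ito, E. Seiler, PoS Confinement8 (2008) 034,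
arXiv:0901.4246, Sect. 4(b) [cite: ItoSeiler2009Critical, Sect. 4(b)]; E. T. Tomboulis, arXiv:0707.2179, App. C (C.6)–(C.8)
[cite: Tomboulis2007Confinement, App. C eqs. (C.6)–(C.8)].
-/

noncomputable section

open Real

namespace Literature.MathematicalPhysics.QuantumFieldTheory

namespace ItoSeiler2008

/-- **Kanazawa's imbedding function** `Ψ(λ, t) = e^{-t} − 1 + 2λ` (Ito–Seiler arXiv:0803.3019 §3.3; arXiv:0901.4246 Sect. 4(b)).
[cite: ItoSeiler2009Critical, Sect. 4(b)] -/
def kanazawaPsi (lam t : ℝ) : ℝ :=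
  Real.exp (-t) - 1 + 2 * lam

/-- Unfolding lemma. [cite: ItoSeiler2009Critical, Sect. 4(b)] -/
theorem kanazawaPsi_def (lam t : ℝ) : kanazawaPsi lam t = Real.exp (-t) - 1 + 2 * lam := rfl

/-- **`∂Ψ/∂t = −e^{−t}`** at every `(λ, t)`. [cite: ItoSeiler2009Critical, Sect. 4(b)] -/
theorem hasDerivAt_kanazawaPsi (lam t : ℝ) : HasDerivAt (kanazawaPsi lam) (-Real.exp (-t)) t := by
  have h : HasDerivAt (fun s : ℝ => Real.exp (-s)) (Real.exp (-t) * (-1)) t := (hasDerivAt_neg t).exp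
  have h2 := (h.sub_const 1).add_const (2 * lam)
  refine (h2.congr_of_eventuallyEq (Filter.Eventually.of_forall fun s => rfl)).congr_deriv ?_
  ring

/-- **The hypothesis Tomboulis's App. C verifies holds here: `Ψ_{,t} ≠ 0` everywhere** (indeed `< 0`).
[cite: ItoSeiler2009Critical, Sect. 4(b)] -/
theorem deriv_kanazawaPsi_ne_zero (lam t : ℝ) : deriv (kanazawaPsi lam) t ≠ 0 := by
  rw [(hasDerivAt_kanazawaPsi lam t).deriv]
  exact neg_ne_zero.2 (Real.exp_pos _).ne'

/-- `Ψ_{,t} < 0` everywhere. [cite: ItoSeiler2009Critical, Sect. 4(b)] -/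
theorem deriv_kanazawaPsi_neg (lam t : ℝ) : deriv (kanazawaPsi lam) t < 0 := by
  rw [(hasDerivAt_kanazawaPsi lam t).deriv]
  exact neg_neg_of_pos (Real.exp_pos _)

/-- **At `λ = 0` the equation `Ψ(0, t) = 0` is solved by `t = 0`.** [cite: ItoSeiler2009Critical, Sect. 4(b)] -/
theorem kanazawaPsi_zero_zero : kanazawaPsi 0 0 = 0 := by
  simp [kanazawaPsi]

/-- **At `λ = 1` the equation `Ψ(1, t) = 0` has NO solution:** `Ψ(1,t) = e^{−t} + 1 > 0`. [cite: ItoSeiler2009Critical, Sect. 4(b)] -/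
theorem kanazawaPsi_one_pos (t : ℝ) : 0 < kanazawaPsi 1 t := by
  have := Real.exp_pos (-t)
  simp only [kanazawaPsi]
  linarith

/-- `Ψ(1, t) ≠ 0` for every `t`. [cite: ItoSeiler2009Critical, Sect. 4(b)] -/
theorem kanazawaPsi_one_ne_zero (t : ℝ) : kanazawaPsi 1 t ≠ 0 := (kanazawaPsi_one_pos t).ne'

/-- **The solution branch:** for `λ < 1/2`, `Ψ(λ, t) = 0 ⟺ t = −log(1 − 2λ)` (the branch `t(λ)` through `(0, 0)`).
[cite: ItoSeiler2009Critical, Sect. 4(b)] -/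
theorem kanazawaPsi_eq_zero_iff {lam : ℝ} (hlam : lam < 1 / 2) (t : ℝ) :
    kanazawaPsi lam t = 0 ↔ t = -Real.log (1 - 2 * lam) := by
  have hpos : 0 < 1 - 2 * lam := by linarith
  simp only [kanazawaPsi]
  constructor
  · intro h
    have h1 : Real.exp (-t) = 1 - 2 * lam := by linarith
    have h2 := congrArg Real.log h1
    rw [Real.log_exp] at h2
    linarith
  · intro h
    rw [h, neg_neg, Real.exp_log hpos]
    ring

/-- **`Ψ(λ, ·)` has a root iff `λ < 1/2`:** the branch through `(0,0)` cannot be continued to `λ = 1` although `Ψ_{,t} ≠ 0`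
everywhere («the condition `Ψ_t(λ,t) ≠ 0` does not guarantee that `t(λ)` can be defined for all `λ`»).
[cite: ItoSeiler2009Critical, Sect. 4(b)] -/
theorem exists_kanazawaPsi_eq_zero_iff (lam : ℝ) : (∃ t, kanazawaPsi lam t = 0) ↔ lam < 1 / 2 := by
  constructor
  · rintro ⟨t, ht⟩
    have := Real.exp_pos (-t)
    simp only [kanazawaPsi] at ht
    linarith
  · intro h
    exact ⟨-Real.log (1 - 2 * lam), (kanazawaPsi_eq_zero_iff h _).2 rfl⟩

/-- **The branch blows up at `λ = 1/2`:** `t(λ) = −log(1 − 2λ) → +∞` as `λ ↑ 1/2`. [cite: ItoSeiler2009Critical, Sect. 4(b)] -/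
theorem tendsto_kanazawa_branch_atTop :
    Filter.Tendsto (fun lam : ℝ => -Real.log (1 - 2 * lam)) (nhdsWithin (1 / 2) (Set.Iio (1 / 2))) Filter.atTop := by
  have h1 : Filter.Tendsto (fun lam : ℝ => 1 - 2 * lam) (nhdsWithin (1 / 2) (Set.Iio (1 / 2))) (nhdsWithin 0 (Set.Ioi 0)) := by
    refine tendsto_nhdsWithin_iff.2 ⟨?_, ?_⟩
    · have : Filter.Tendsto (fun lam : ℝ => 1 - 2 * lam) (nhds (1 / 2)) (nhds (1 - 2 * (1 / 2))) :=
        (continuous_const.sub (continuous_const.mul continuous_id)).tendsto _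
      rw [show (1 : ℝ) - 2 * (1 / 2) = 0 by norm_num] at this
      exact this.mono_left nhdsWithin_le_nhds
    · filter_upwards [self_mem_nhdsWithin] with lam hlam
      simp only [Set.mem_Iio] at hlam
      simp only [Set.mem_Ioi]
      linarith
  have h2 := Real.tendsto_log_nhdsGT_zero.comp h1
  exact Filter.tendsto_neg_atBot_atTop.comp h2

/-- **Ito–Seiler's Problem 3 / Kanazawa's counterexample, packaged:** there is a smooth `Ψ : ℝ → ℝ → ℝ` with `Ψ_{,t} ≠ 0` at every
point, a solution of `Ψ(0, t) = 0`, and NO solution of `Ψ(1, t) = 0` — so «`Ψ_{,t} ≠ 0` along the branch» does not by itself give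
the continuation `t(0) → t(1)` used in Tomboulis's App. C. [cite: ItoSeiler2009Critical, Sect. 4(b)] -/
theorem itoSeiler_problem3_counterexample :
    ∃ Ψ : ℝ → ℝ → ℝ, (∀ lam t, DifferentiableAt ℝ (Ψ lam) t ∧ deriv (Ψ lam) t ≠ 0) ∧ (∃ t, Ψ 0 t = 0) ∧ ¬ ∃ t, Ψ 1 t = 0 :=
  ⟨kanazawaPsi, fun lam t => ⟨(hasDerivAt_kanazawaPsi lam t).differentiableAt, deriv_kanazawaPsi_ne_zero lam t⟩,
    ⟨0, kanazawaPsi_zero_zero⟩, fun ⟨t, ht⟩ => kanazawaPsi_one_ne_zero t ht⟩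

end ItoSeiler2008

end Literature.MathematicalPhysics.QuantumFieldTheory

end
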